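import Literature.LinearAlgebra.Matrix.QInversiveCharpoly
import Mathlib.FieldTheory.IsAlgClosed.AlgebraicClosure
import HarnessLib

/-!
# Goresky–Tai 2017, Lemma 12 (1) ⟺ (2): for a `q`-inversive `γ = (A B; C ᵗA)` the blocks `A, B, C` are
# nonsingular iff `γ` has no eigenvalue in `{±√q, ±√−q}`

Topic `Literature/LinearAlgebra/Matrix`; THEOREMS ONLY (no definition, no instance, no named fact; D-0026 net
debt 0).  Lane `lit-hodgefound` (summit `HodgeConjecture`, Track 2 foundations library), seat
`lit-hodgefound-p15`, generation 56, row g56-#6; sequel of `QInversiveCharpoly` (g56-#3: the block relations and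
`γ·(τ₀γτ₀) = q·1`).

THE PRINT.  M. Goresky, Y.-S. Tai, *Real structures on ordinary Abelian varieties*, arXiv:1701.07742
[GoreskyTai2017RealStructuresOrdinary], §4.1 (p0011), verbatim:

> **Lemma 12.** Let `γ = (A B; C ᵗA) ∈ GSp_{2n}(ℚ)` be `q`-inversive. Then the following statements are
> equivalent. (1) The matrices `A`, `B`, and `C` are nonsingular. (2) The element `γ` has no eigenvalues in the
> set `{±√q, ±√−q}`. …
> *Proof.* One checks that if `w = (u; v)` is an eigenvector of `γ` with eigenvalue `λ` then (a) `τ₀(w) = (−u; v)`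
> is an eigenvector of `γ` with eigenvalue `q/λ` (b) `u` is an eigenvector of `A` with eigenvalue `½(λ + q/λ)`
> (c) `v` is an eigenvector of `ᵗA` with eigenvalue `½(λ + q/λ)`. Therefore, if `λ = ±√q` is an eigenvalue of `γ`
> then it is also an eigenvalue of `A`, hence `BC = A² − qI` is singular. If `λ = ±√−q` is an eigenvalue of `γ`
> then `λ + q/λ = 0` so `A` is singular. Conversely, if `A` is singular, say `Au = 0` then
> `(A B; C ᵗA)(√−q u; Cu) = … = √−q (√−q u; Cu)` so `√−q` is an eigenvalue of `γ`. If `C` is singular then there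
> exists a nonzero vector `u` so that `Cu = 0` and `Au = √q u` so … `√q` is an eigenvalue of `γ`. If `C` is
> nonsingular but `B` is singular then … eigenvalue `√q`. This proves that conditions (1) and (2) are equivalent.

WHAT IS HERE (any field `K` with `2 ≠ 0` and `q ≠ 0` — the print: `ℚ`, `q = pᵃ`; `γ = (A B; C ᵗA)` with the
`q`-inversive relations `ᵗB = B`, `ᵗC = C`, `AB = BᵗA`, `CA = ᵗAC`, `A² − BC = q·1` of `QInversiveCharpoly`).
The «eigenvalues of `γ`» live in an algebraic closure `K̄` (or any extension field `L ⊇ K`): they are the roots of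
`p_γ` read in `L`.  The route is not the printed eigenvector computation but the determinant identities
`γ² + q·1 = γ·diag(2A, 2ᵗA)`, `γ² − q·1 = γ·(0 2B; 2C 0)` (from `γ·(τ₀γτ₀) = q·1`) and
`(λ·1 − γ)(−λ·1 − γ) = γ² − λ²·1`, so that `p_γ(λ)·p_γ(−λ) = det(γ² ∓ q·1)` whenever `λ² = ±q`:
* §1 the identities over any commutative ring: `sq_add_smul_one_eq`, `sq_sub_smul_one_eq`,
  `scalar_sub_mul_neg_scalar_sub`, `eval_mul_eval_neg_eq_det` (`p_N(λ)p_N(−λ) = det(N² − λ²·1)`),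
  `det_fromBlocks_zero_zero_mul_swap` (`det (0 B; C 0) · det (0 1; 1 0) = det B · det C`).
* §2 over a field: `det_ne_zero` (a `q`-inversive `γ` is invertible for `q ≠ 0`), `det_sq_add_ne_zero_iff`
  (`det(γ² + q) ≠ 0 ⟺ det A ≠ 0`), `det_sq_sub_ne_zero_iff` (`det(γ² − q) ≠ 0 ⟺ det B ≠ 0 ∧ det C ≠ 0`).
* §3 **LEMMA 12**: (1) ⟹ (2) in EVERY extension field (**`not_isRoot_of_sq_eq_neg`**: `det A ≠ 0` forbids roots
  with `λ² = −q` — «if `λ = ±√−q` is an eigenvalue … `A` is singular»; **`not_isRoot_of_sq_eq`**: `det B, det C ≠ 0`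
  forbid roots with `λ² = q` — «`BC = A² − qI` is singular»), the converses in any extension containing the square
  root (`isRoot_or_isRoot_neg_of_det_A_eq_zero`: `det A = 0 ⟹ p_γ(±√−q) = 0` — «Conversely, if `A` is singular …
  `√−q` is an eigenvalue»; `isRoot_or_isRoot_neg_of_det_B_C_eq_zero`: `det B = 0 ∨ det C = 0 ⟹ p_γ(±√q) = 0` —
  «If `C` is singular … If `C` is nonsingular but `B` is singular …»), and the equivalence
  `det A ≠ 0 ∧ det B ≠ 0 ∧ det C ≠ 0 ⟺ no `λ` with `λ² = −q` or `λ² = q` is a root of `p_γ`, read in an extension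
  with both square roots (`nonsingular_blocks_iff_of_sq_eq`), in any algebraically closed extension, e.g. `ℚ ⊂ ℂ`
  (**`nonsingular_blocks_iff_of_isAlgClosed`**), in `K̄` (**`nonsingular_blocks_iff`**).

NOT here: the remaining clauses of Lemma 12 («`A` is semisimple»; (4.3) is `QInversiveEigenvalueBound`) and its
converse construction (`QInversiveCompanion.completion_relations_left`).

## References
* [GoreskyTai2017RealStructuresOrdinary] M. Goresky, Y.-S. Tai, Real structures on ordinary Abelian varieties,
  arXiv:1701.07742 (2017), §4.1 Lemma 12 (1) ⟺ (2) with proof (p0011).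
-/

open Matrix Polynomial Finset

namespace Literature.LinearAlgebra.Matrix.QInversiveNonsingularBlocks

/-! ## §1 Identities over a commutative ring -/

section CommRing

variable {R : Type*} [CommRing R] {m : Type*} [Fintype m] [DecidableEq m]

/-- `γ² + q·1 = γ · diag(A + A, ᵗA + ᵗA)` for a `q`-inversive `γ` (from `γ·(τ₀γτ₀) = q·1` and
`γ + τ₀γτ₀ = diag(2A, 2ᵗA)`). [cite: GoreskyTai2017RealStructuresOrdinary, §4.1 proof of Lemma 12 (b) «u is an eigenvector of A with eigenvalue ½(λ + q/λ)» (p0011)] -/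
theorem sq_add_smul_one_eq {A B C : Matrix m m R} {q : R} (hB : Bᵀ = B) (hC : Cᵀ = C) (hAB : A * B = B * Aᵀ)
    (hCA : C * A = Aᵀ * C) (hq : A * A - B * C = q • (1 : Matrix m m R)) :
    fromBlocks A B C Aᵀ * fromBlocks A B C Aᵀ + q • (1 : Matrix (m ⊕ m) (m ⊕ m) R) =
      fromBlocks A B C Aᵀ * fromBlocks (A + A) 0 0 (Aᵀ + Aᵀ) := by
  rw [← QInversiveCharpoly.mul_tau0Conj_eq_smul_one hB hC hAB hCA hq, ← Matrix.mul_add, fromBlocks_add]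
  congr 2 <;> abel

/-- `γ² − q·1 = γ · (0 2B; 2C 0)` for a `q`-inversive `γ`. [cite: GoreskyTai2017RealStructuresOrdinary, §4.1 proof of Lemma 12 «hence BC = A² − qI is singular» (p0011)] -/
theorem sq_sub_smul_one_eq {A B C : Matrix m m R} {q : R} (hB : Bᵀ = B) (hC : Cᵀ = C) (hAB : A * B = B * Aᵀ)
    (hCA : C * A = Aᵀ * C) (hq : A * A - B * C = q • (1 : Matrix m m R)) :
    fromBlocks A B C Aᵀ * fromBlocks A B C Aᵀ - q • (1 : Matrix (m ⊕ m) (m ⊕ m) R) =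
      fromBlocks A B C Aᵀ * fromBlocks 0 (B + B) (C + C) 0 := by
  rw [← QInversiveCharpoly.mul_tau0Conj_eq_smul_one hB hC hAB hCA hq, ← Matrix.mul_sub, sub_eq_add_neg,
    fromBlocks_neg, fromBlocks_add]
  congr 2 <;> abel

/-- `(λ·1 − N)(−λ·1 − N) = N² − λ²·1` for any square matrix `N`. [cite: GoreskyTai2017RealStructuresOrdinary, §4.1 proof of Lemma 12 (a) (the eigenvalues come in pairs over λ² = ±q) (p0011)] -/
theorem scalar_sub_mul_neg_scalar_sub {n : Type*} [Fintype n] [DecidableEq n] (N : Matrix n n R) (x : R) :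
    (scalar n x - N) * (scalar n (-x) - N) = N * N - (x ^ 2) • (1 : Matrix n n R) := by
  rw [scalar_apply, scalar_apply, ← smul_one_eq_diagonal, ← smul_one_eq_diagonal]
  simp only [sub_mul, mul_sub, Matrix.smul_mul, Matrix.mul_smul, Matrix.one_mul, Matrix.mul_one, smul_smul,
    neg_smul, sq, mul_neg]
  abel

/-- **`p_N(λ) · p_N(−λ) = det(N² − λ²·1)`** for any square matrix `N` over a commutative ring.
[cite: GoreskyTai2017RealStructuresOrdinary, §4.1 proof of Lemma 12 (a) «τ₀(w) is an eigenvector of γ with eigenvalue q/λ» (the pairing of the eigenvalues λ, −λ over λ² = ±q) (p0011)] -/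
theorem eval_mul_eval_neg_eq_det {n : Type*} [Fintype n] [DecidableEq n] (N : Matrix n n R) (x : R) :
    N.charpoly.eval x * N.charpoly.eval (-x) = (N * N - (x ^ 2) • (1 : Matrix n n R)).det := by
  rw [eval_charpoly, eval_charpoly, ← det_mul, scalar_sub_mul_neg_scalar_sub]

/-- `(0 B; C 0) · (0 1; 1 0) = diag(B, C)`. [folklore] -/
private theorem fromBlocks_zero_zero_mul_swap (B C : Matrix m m R) :
    fromBlocks 0 B C 0 * fromBlocks (0 : Matrix m m R) (1 : Matrix m m R) (1 : Matrix m m R) (0 : Matrix m m R) = fromBlocks B 0 0 C := by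
  rw [fromBlocks_multiply]
  simp

/-- `(0 1; 1 0)² = 1`. [folklore] -/
private theorem swap_mul_swap :
    fromBlocks (0 : Matrix m m R) (1 : Matrix m m R) (1 : Matrix m m R) (0 : Matrix m m R) * fromBlocks (0 : Matrix m m R) (1 : Matrix m m R) (1 : Matrix m m R) (0 : Matrix m m R) = 1 := by
  rw [fromBlocks_multiply, ← fromBlocks_one]
  simp

/-- `det (0 B; C 0) · det (0 1; 1 0) = det B · det C`. [cite: GoreskyTai2017RealStructuresOrdinary, §4.1 proof of Lemma 12 «If C is singular … If C is nonsingular but B is singular» (p0011)] -/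
theorem det_fromBlocks_zero_zero_mul_swap (B C : Matrix m m R) :
    (fromBlocks 0 B C 0).det * (fromBlocks (0 : Matrix m m R) (1 : Matrix m m R) (1 : Matrix m m R) (0 : Matrix m m R)).det = B.det * C.det := by
  rw [← det_mul, fromBlocks_zero_zero_mul_swap, det_fromBlocks_zero₂₁]

/-- The mapped square `±` constant: `f[γ² ± c·1] = (f γ)² ± f(c)·1`. [folklore] -/
private theorem map_mul_self_add_smul_one {S : Type*} [CommRing S] (f : R →+* S) {n : Type*} [Fintype n]
    [DecidableEq n] (N : Matrix n n R) (c : R) :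
    (N * N + c • (1 : Matrix n n R)).map f = N.map f * N.map f + f c • (1 : Matrix n n S) := by
  rw [Matrix.map_add f (map_add f), Matrix.map_mul, Matrix.map_smul' f c _ (map_mul f),
    Matrix.map_one f (map_zero f) (map_one f)]

end CommRing

/-! ## §2 Over a field: `det γ ≠ 0`, `det(γ² ± q) ≠ 0` versus the blocks -/

section Field

variable {K : Type*} [Field K] {m : Type*} [Fintype m] [DecidableEq m]

/-- A `q`-inversive `γ` with `q ≠ 0` is invertible: `det γ ≠ 0` (from `γ·(τ₀γτ₀) = q·1`).
[cite: GoreskyTai2017RealStructuresOrdinary, §4.1 «τ₀ γ τ₀⁻¹ = q γ⁻¹» (p0011)] -/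
theorem det_ne_zero {A B C : Matrix m m K} {q : K} (hq0 : q ≠ 0) (hB : Bᵀ = B) (hC : Cᵀ = C)
    (hAB : A * B = B * Aᵀ) (hCA : C * A = Aᵀ * C) (hq : A * A - B * C = q • (1 : Matrix m m K)) :
    (fromBlocks A B C Aᵀ).det ≠ 0 := by
  have h := congrArg det (QInversiveCharpoly.mul_tau0Conj_eq_smul_one hB hC hAB hCA hq)
  rw [det_mul, det_smul, det_one, mul_one] at h
  intro h0
  rw [h0, zero_mul] at h
  exact pow_ne_zero _ hq0 h.symm

/-- `det(γ² + q·1) ≠ 0 ⟺ det A ≠ 0` (`2 ≠ 0`, `q ≠ 0`). [cite: GoreskyTai2017RealStructuresOrdinary, §4.1 proof of Lemma 12 «If λ = ±√−q is an eigenvalue of γ then λ + q/λ = 0 so A is singular. Conversely, if A is singular …» (p0011)] -/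
theorem det_sq_add_ne_zero_iff (h2 : (2 : K) ≠ 0) {A B C : Matrix m m K} {q : K} (hq0 : q ≠ 0)
    (hB : Bᵀ = B) (hC : Cᵀ = C) (hAB : A * B = B * Aᵀ) (hCA : C * A = Aᵀ * C)
    (hq : A * A - B * C = q • (1 : Matrix m m K)) :
    (fromBlocks A B C Aᵀ * fromBlocks A B C Aᵀ + q • (1 : Matrix (m ⊕ m) (m ⊕ m) K)).det ≠ 0 ↔
      A.det ≠ 0 := by
  rw [sq_add_smul_one_eq hB hC hAB hCA hq, det_mul, det_fromBlocks_zero₂₁, ← two_smul K A, ← two_smul K Aᵀ,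
    det_smul, det_smul, det_transpose]
  have hγ := det_ne_zero hq0 hB hC hAB hCA hq
  have h2n : (2 : K) ^ Fintype.card m ≠ 0 := pow_ne_zero _ h2
  simp only [ne_eq, mul_eq_zero, hγ, h2n, false_or, or_self]

/-- `det(γ² − q·1) ≠ 0 ⟺ det B ≠ 0 ∧ det C ≠ 0` (`2 ≠ 0`, `q ≠ 0`). [cite: GoreskyTai2017RealStructuresOrdinary, §4.1 proof of Lemma 12 «hence BC = A² − qI is singular … If C is singular … If C is nonsingular but B is singular» (p0011)] -/
theorem det_sq_sub_ne_zero_iff (h2 : (2 : K) ≠ 0) {A B C : Matrix m m K} {q : K} (hq0 : q ≠ 0)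
    (hB : Bᵀ = B) (hC : Cᵀ = C) (hAB : A * B = B * Aᵀ) (hCA : C * A = Aᵀ * C)
    (hq : A * A - B * C = q • (1 : Matrix m m K)) :
    (fromBlocks A B C Aᵀ * fromBlocks A B C Aᵀ - q • (1 : Matrix (m ⊕ m) (m ⊕ m) K)).det ≠ 0 ↔
      B.det ≠ 0 ∧ C.det ≠ 0 := by
  rw [sq_sub_smul_one_eq hB hC hAB hCA hq, det_mul]
  have hγ := det_ne_zero hq0 hB hC hAB hCA hq
  have h2n : (2 : K) ^ Fintype.card m ≠ 0 := pow_ne_zero _ h2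
  have hsw : (fromBlocks (0 : Matrix m m K) (1 : Matrix m m K) (1 : Matrix m m K) (0 : Matrix m m K)).det ≠ 0 :=
    (isUnit_det_of_left_inverse swap_mul_swap).ne_zero
  have hBB : (B + B).det = 2 ^ Fintype.card m * B.det := by rw [← two_smul K B, det_smul]
  have hCC : (C + C).det = 2 ^ Fintype.card m * C.det := by rw [← two_smul K C, det_smul]
  have hprod := det_fromBlocks_zero_zero_mul_swap (B + B) (C + C)
  rw [hBB, hCC] at hprod
  have key : (fromBlocks 0 (B + B) (C + C) 0).det ≠ 0 ↔ B.det ≠ 0 ∧ C.det ≠ 0 := by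
    constructor
    · intro hN
      have h4 : 2 ^ Fintype.card m * B.det * (2 ^ Fintype.card m * C.det) ≠ 0 := by
        rw [← hprod]; exact mul_ne_zero hN hsw
      exact ⟨right_ne_zero_of_mul (left_ne_zero_of_mul h4), right_ne_zero_of_mul (right_ne_zero_of_mul h4)⟩
    · rintro ⟨hBd, hCd⟩ hN
      rw [hN, zero_mul] at hprod
      exact mul_ne_zero (mul_ne_zero h2n hBd) (mul_ne_zero h2n hCd) hprod.symm
  rw [mul_ne_zero_iff, key]
  exact ⟨fun h => h.2, fun h => ⟨hγ, h⟩⟩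

/-! ## §3 Lemma 12 (1) ⟺ (2) -/

/-- In an extension field `f : K → L`: `p_γ(λ) · p_γ(−λ) = f(det(γ² + q·1))` when `λ² = −f(q)`, and
`= f(det(γ² − q·1))` when `λ² = f(q)`. [cite: GoreskyTai2017RealStructuresOrdinary, §4.1 proof of Lemma 12 (p0011)] -/
theorem eval_mul_eval_neg_of_sq_eq {L : Type*} [Field L] (f : K →+* L) (N : Matrix (m ⊕ m) (m ⊕ m) K)
    {c : K} {x : L} (hx : x ^ 2 = -f c) :
    (N.charpoly.map f).eval x * (N.charpoly.map f).eval (-x) =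
      f ((N * N + c • (1 : Matrix (m ⊕ m) (m ⊕ m) K)).det) := by
  rw [← charpoly_map, eval_mul_eval_neg_eq_det, RingHom.map_det, RingHom.mapMatrix_apply,
    map_mul_self_add_smul_one, hx, neg_smul, sub_neg_eq_add]

/-- **(1) ⟹ (2), the `±√−q` half, in every extension field**: if `det A ≠ 0` then no `λ` with `λ² = −q` is a
root of `p_γ` («if `λ = ±√−q` is an eigenvalue of `γ` then `λ + q/λ = 0` so `A` is singular»).
[cite: GoreskyTai2017RealStructuresOrdinary, §4.1 Lemma 12 (1) ⟹ (2) (p0011)] -/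
theorem not_isRoot_of_sq_eq_neg (h2 : (2 : K) ≠ 0) {A B C : Matrix m m K} {q : K} (hq0 : q ≠ 0)
    (hB : Bᵀ = B) (hC : Cᵀ = C) (hAB : A * B = B * Aᵀ) (hCA : C * A = Aᵀ * C)
    (hq : A * A - B * C = q • (1 : Matrix m m K)) (hA : A.det ≠ 0) {L : Type*} [Field L] (f : K →+* L)
    {x : L} (hx : x ^ 2 = -f q) : ¬ ((fromBlocks A B C Aᵀ).charpoly.map f).IsRoot x := by
  intro hroot
  have h := eval_mul_eval_neg_of_sq_eq f (fromBlocks A B C Aᵀ) hx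
  rw [hroot.eq_zero, zero_mul] at h
  exact ((det_sq_add_ne_zero_iff h2 hq0 hB hC hAB hCA hq).mpr hA) (f.injective (by rw [map_zero]; exact h.symm))

/-- **(1) ⟹ (2), the `±√q` half, in every extension field**: if `det B ≠ 0` and `det C ≠ 0` then no `λ` with
`λ² = q` is a root of `p_γ` («if `λ = ±√q` is an eigenvalue … `BC = A² − qI` is singular»).
[cite: GoreskyTai2017RealStructuresOrdinary, §4.1 Lemma 12 (1) ⟹ (2) (p0011)] -/
theorem not_isRoot_of_sq_eq (h2 : (2 : K) ≠ 0) {A B C : Matrix m m K} {q : K} (hq0 : q ≠ 0) (hB : Bᵀ = B)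
    (hC : Cᵀ = C) (hAB : A * B = B * Aᵀ) (hCA : C * A = Aᵀ * C)
    (hq : A * A - B * C = q • (1 : Matrix m m K)) (hBd : B.det ≠ 0) (hCd : C.det ≠ 0) {L : Type*} [Field L]
    (f : K →+* L) {x : L} (hx : x ^ 2 = f q) : ¬ ((fromBlocks A B C Aᵀ).charpoly.map f).IsRoot x := by
  intro hroot
  have hx' : x ^ 2 = -f (-q) := by rw [map_neg, neg_neg]; exact hx
  have h := eval_mul_eval_neg_of_sq_eq f (fromBlocks A B C Aᵀ) hx'
  rw [hroot.eq_zero, zero_mul, neg_smul, ← sub_eq_add_neg] at h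
  exact ((det_sq_sub_ne_zero_iff h2 hq0 hB hC hAB hCA hq).mpr ⟨hBd, hCd⟩)
    (f.injective (by rw [map_zero]; exact h.symm))

/-- **(2) ⟹ (1), the `√−q` half, in any extension containing `√−q`**: if `A` is singular then `√−q` or `−√−q`
is a root of `p_γ` («Conversely, if `A` is singular, say `Au = 0` then … so `√−q` is an eigenvalue of `γ`»).
[cite: GoreskyTai2017RealStructuresOrdinary, §4.1 proof of Lemma 12 (2) ⟹ (1) (p0011)] -/
theorem isRoot_or_isRoot_neg_of_det_A_eq_zero (h2 : (2 : K) ≠ 0) {A B C : Matrix m m K} {q : K} (hq0 : q ≠ 0)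
    (hB : Bᵀ = B) (hC : Cᵀ = C) (hAB : A * B = B * Aᵀ) (hCA : C * A = Aᵀ * C)
    (hq : A * A - B * C = q • (1 : Matrix m m K)) (hA : A.det = 0) {L : Type*} [Field L] (f : K →+* L)
    {x : L} (hx : x ^ 2 = -f q) :
    ((fromBlocks A B C Aᵀ).charpoly.map f).IsRoot x ∨ ((fromBlocks A B C Aᵀ).charpoly.map f).IsRoot (-x) := by
  have h := eval_mul_eval_neg_of_sq_eq f (fromBlocks A B C Aᵀ) hx
  have h0 : (fromBlocks A B C Aᵀ * fromBlocks A B C Aᵀ + q • (1 : Matrix (m ⊕ m) (m ⊕ m) K)).det = 0 := by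
    by_contra h0
    exact ((det_sq_add_ne_zero_iff h2 hq0 hB hC hAB hCA hq).mp h0) hA
  rw [h0, map_zero, mul_eq_zero] at h
  exact h

/-- **(2) ⟹ (1), the `√q` half, in any extension containing `√q`**: if `B` or `C` is singular then `√q` or `−√q` is
a root of `p_γ` («If `C` is singular … `√q` is an eigenvalue of `γ`. If `C` is nonsingular but `B` is singular …
with eigenvalue `√q`»). [cite: GoreskyTai2017RealStructuresOrdinary, §4.1 proof of Lemma 12 (2) ⟹ (1) (p0011)] -/
theorem isRoot_or_isRoot_neg_of_det_B_C_eq_zero (h2 : (2 : K) ≠ 0) {A B C : Matrix m m K} {q : K}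
    (hq0 : q ≠ 0) (hB : Bᵀ = B) (hC : Cᵀ = C) (hAB : A * B = B * Aᵀ) (hCA : C * A = Aᵀ * C)
    (hq : A * A - B * C = q • (1 : Matrix m m K)) (hBC : B.det = 0 ∨ C.det = 0) {L : Type*} [Field L]
    (f : K →+* L) {x : L} (hx : x ^ 2 = f q) :
    ((fromBlocks A B C Aᵀ).charpoly.map f).IsRoot x ∨ ((fromBlocks A B C Aᵀ).charpoly.map f).IsRoot (-x) := by
  have hxq : x ^ 2 = -f (-q) := by rw [map_neg, neg_neg]; exact hx
  have h := eval_mul_eval_neg_of_sq_eq f (fromBlocks A B C Aᵀ) hxq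
  rw [neg_smul, ← sub_eq_add_neg] at h
  have h0 : (fromBlocks A B C Aᵀ * fromBlocks A B C Aᵀ - q • (1 : Matrix (m ⊕ m) (m ⊕ m) K)).det = 0 := by
    by_contra h0
    obtain ⟨hBd, hCd⟩ := (det_sq_sub_ne_zero_iff h2 hq0 hB hC hAB hCA hq).mp h0
    exact hBC.elim hBd hCd
  rw [h0, map_zero, mul_eq_zero] at h
  exact h

/-- **Lemma 12, (1) ⟺ (2), read in any extension field `L ⊇ K` containing square roots `i² = −q`, `r² = q`**:
`A, B, C` are all nonsingular iff none of `±r = ±√q`, `±i = ±√−q` (i.e. no `λ ∈ L` with `λ² = ∓q`) is a root of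
`p_γ`. [cite: GoreskyTai2017RealStructuresOrdinary, §4.1 Lemma 12 (1) ⟺ (2) (p0011)] -/
theorem nonsingular_blocks_iff_of_sq_eq (h2 : (2 : K) ≠ 0) {A B C : Matrix m m K} {q : K} (hq0 : q ≠ 0)
    (hB : Bᵀ = B) (hC : Cᵀ = C) (hAB : A * B = B * Aᵀ) (hCA : C * A = Aᵀ * C)
    (hq : A * A - B * C = q • (1 : Matrix m m K)) {L : Type*} [Field L] (f : K →+* L) {i r : L}
    (hi : i ^ 2 = -f q) (hr : r ^ 2 = f q) :
    (A.det ≠ 0 ∧ B.det ≠ 0 ∧ C.det ≠ 0) ↔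
      ∀ x : L, (x ^ 2 = -f q ∨ x ^ 2 = f q) → ¬ ((fromBlocks A B C Aᵀ).charpoly.map f).IsRoot x := by
  constructor
  · rintro ⟨hA, hBd, hCd⟩ x hx
    rcases hx with hx | hx
    · exact not_isRoot_of_sq_eq_neg h2 hq0 hB hC hAB hCA hq hA _ hx
    · exact not_isRoot_of_sq_eq h2 hq0 hB hC hAB hCA hq hBd hCd _ hx
  · intro H
    have hi' : (-i) ^ 2 = -f q := by rw [neg_sq]; exact hi
    have hr' : (-r) ^ 2 = f q := by rw [neg_sq]; exact hr
    refine ⟨?_, ?_, ?_⟩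
    · intro hA
      rcases isRoot_or_isRoot_neg_of_det_A_eq_zero h2 hq0 hB hC hAB hCA hq hA f hi with h | h
      · exact H i (Or.inl hi) h
      · exact H (-i) (Or.inl hi') h
    · intro hBd
      rcases isRoot_or_isRoot_neg_of_det_B_C_eq_zero h2 hq0 hB hC hAB hCA hq (Or.inl hBd) f hr
        with h | h
      · exact H r (Or.inr hr) h
      · exact H (-r) (Or.inr hr') h
    · intro hCd
      rcases isRoot_or_isRoot_neg_of_det_B_C_eq_zero h2 hq0 hB hC hAB hCA hq (Or.inr hCd) f hr
        with h | h
      · exact H r (Or.inr hr) h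
      · exact H (-r) (Or.inr hr') h

/-- **Lemma 12, (1) ⟺ (2), in any algebraically closed extension** (e.g. `ℚ ⊂ ℂ` as printed, `γ ∈ GSp_{2n}(ℚ)`):
`A, B, C` nonsingular iff `γ` has no eigenvalue `λ ∈ L` with `λ² = −q` or `λ² = q`, i.e. none in
`{±√q, ±√−q}`. [cite: GoreskyTai2017RealStructuresOrdinary, §4.1 Lemma 12 «(1) The matrices A, B, and C are nonsingular. (2) The element γ has no eigenvalues in the set {±√q, ±√−q}» (p0011)] -/
theorem nonsingular_blocks_iff_of_isAlgClosed (h2 : (2 : K) ≠ 0) {A B C : Matrix m m K} {q : K} (hq0 : q ≠ 0)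
    (hB : Bᵀ = B) (hC : Cᵀ = C) (hAB : A * B = B * Aᵀ) (hCA : C * A = Aᵀ * C)
    (hq : A * A - B * C = q • (1 : Matrix m m K)) {L : Type*} [Field L] [IsAlgClosed L] (f : K →+* L) :
    (A.det ≠ 0 ∧ B.det ≠ 0 ∧ C.det ≠ 0) ↔
      ∀ x : L, (x ^ 2 = -f q ∨ x ^ 2 = f q) → ¬ ((fromBlocks A B C Aᵀ).charpoly.map f).IsRoot x := by
  obtain ⟨i, hi⟩ := IsAlgClosed.exists_pow_nat_eq (-f q) two_pos
  obtain ⟨r, hr⟩ := IsAlgClosed.exists_pow_nat_eq (f q) two_pos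
  exact nonsingular_blocks_iff_of_sq_eq h2 hq0 hB hC hAB hCA hq f hi hr

/-- **Lemma 12, (1) ⟺ (2)**: for a `q`-inversive `γ = (A B; C ᵗA)` over a field `K` with `2 ≠ 0`, `q ≠ 0`, the
blocks `A, B, C` are all nonsingular iff `γ` has no eigenvalue `λ` in an algebraic closure `K̄` with `λ² = −q`
or `λ² = q`, i.e. none of `±√q, ±√−q` is a root of `p_γ`.
[cite: GoreskyTai2017RealStructuresOrdinary, §4.1 Lemma 12 «the following statements are equivalent. (1) The matrices A, B, and C are nonsingular. (2) The element γ has no eigenvalues in the set {±√q, ±√−q}» (p0011)] -/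
theorem nonsingular_blocks_iff (h2 : (2 : K) ≠ 0) {A B C : Matrix m m K} {q : K} (hq0 : q ≠ 0)
    (hB : Bᵀ = B) (hC : Cᵀ = C) (hAB : A * B = B * Aᵀ) (hCA : C * A = Aᵀ * C)
    (hq : A * A - B * C = q • (1 : Matrix m m K)) :
    (A.det ≠ 0 ∧ B.det ≠ 0 ∧ C.det ≠ 0) ↔
      ∀ x : AlgebraicClosure K,
        (x ^ 2 = -algebraMap K (AlgebraicClosure K) q ∨ x ^ 2 = algebraMap K (AlgebraicClosure K) q) →
          ¬ ((fromBlocks A B C Aᵀ).charpoly.map (algebraMap K (AlgebraicClosure K))).IsRoot x :=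
  nonsingular_blocks_iff_of_isAlgClosed h2 hq0 hB hC hAB hCA hq (algebraMap K (AlgebraicClosure K))

end Field

end Literature.LinearAlgebra.Matrix.QInversiveNonsingularBlocks
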